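import Mathlib.Topology.Algebra.Order.Archimedean
import Mathlib.NumberTheory.Real.Irrational
import Mathlib.Analysis.SpecialFunctions.Trigonometric.Basic

/-!
# Crux `SymmetricScarExists` (stmt-NavierStokesRegularity-11718), line `rdss-screw-split` —
# the group-theoretic core of AUX-1 / AUX-6: a closed stabiliser containing an irrational rotation
# is everything

Helper file of the line lead (`--supports stmt-NavierStokesRegularity-11718`; pure topology of `ℝ`).
If a set `S ⊆ ℝ` of angles is an additive subgroup (contains `0`, closed under `+` and `−`), is
topologically closed, and contains `2π` and an angle `θ` with `θ/2π` irrational, then `S = ℝ`: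
by `AddSubgroup.dense_or_cyclic` the subgroup is dense or cyclic; cyclic is impossible because
`θ = m a`, `2π = n a` would make `θ/2π = m/n` rational; dense and closed is everything.  This is the
abstract form of "the stabiliser of a continuous object under the rotations `R_φ` about a fixed axis,
if it contains a rotation by an irrational angle, is all of `SO(2)`", used by the auxiliary stubs
`stub_irrationalRotationApexFatal` (AUX-1) and `stub_irrationalScarRotation` (AUX-6).

## References

* N. Bourbaki, *General Topology*, Ch. V §1 no. 1 Prop. 1 (closed subgroups of `ℝ`). [folklore]
-/

noncomputable section

open Set Topology

namespace Summit.NavierStokesRegularity.NavierStokesRegularity.Theorems.SymmetricScarExists.RdssSplit.NearIdentity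

set_option linter.dupNamespace false

/-- **A closed additive subgroup of `ℝ` containing `2π` and an angle incommensurable with `2π` is
all of `ℝ`** (`AddSubgroup` form): dense-or-cyclic, and cyclic would make `θ/2π` rational. [folklore] -/
theorem addSubgroup_eq_top_of_irrational_angle (S : AddSubgroup ℝ) (hS : IsClosed (S : Set ℝ))
    {θ : ℝ} (hθ : θ ∈ S) (h2π : 2 * Real.pi ∈ S) (hirr : Irrational (θ / (2 * Real.pi))) :
    (S : Set ℝ) = univ := by
  rcases S.dense_or_cyclic with hd | ⟨a, ha⟩
  · rw [← hS.closure_eq]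
    exact hd.closure_eq
  · exfalso
    have hθ' : θ ∈ AddSubgroup.closure {a} := ha ▸ hθ
    have h2π' : 2 * Real.pi ∈ AddSubgroup.closure {a} := ha ▸ h2π
    obtain ⟨m, hm⟩ := AddSubgroup.mem_closure_singleton.1 hθ'
    obtain ⟨n, hn⟩ := AddSubgroup.mem_closure_singleton.1 h2π'
    have hπ0 : (2 * Real.pi) ≠ 0 := by positivity
    have hn0 : (n : ℝ) ≠ 0 := by
      intro h
      apply hπ0
      rw [← hn, zsmul_eq_mul, h, zero_mul]
    have ha0 : a ≠ 0 := by
      intro h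
      apply hπ0
      rw [← hn, h, smul_zero]
    refine hirr ⟨(m : ℚ) / (n : ℚ), ?_⟩
    rw [← hm, ← hn, zsmul_eq_mul, zsmul_eq_mul]
    push_cast
    field_simp

/-- **Predicate form** of `addSubgroup_eq_top_of_irrational_angle`: a property of angles that holds
at `0`, is stable under sums and negatives, defines a closed set, and holds at `2π` and at some `θ`
with `θ/2π` irrational, holds at every angle. [folklore] -/
theorem forall_of_irrational_angle_stabiliser {P : ℝ → Prop} (h0 : P 0)
    (hadd : ∀ φ ψ : ℝ, P φ → P ψ → P (φ + ψ)) (hneg : ∀ φ : ℝ, P φ → P (-φ))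
    (hclosed : IsClosed {φ : ℝ | P φ}) {θ : ℝ} (hθ : P θ) (h2π : P (2 * Real.pi))
    (hirr : Irrational (θ / (2 * Real.pi))) : ∀ φ : ℝ, P φ := by
  let S : AddSubgroup ℝ :=
    { carrier := {φ : ℝ | P φ}
      add_mem' := fun {a b} ha hb => hadd a b ha hb
      zero_mem' := h0
      neg_mem' := fun {a} ha => hneg a ha }
  have hS : ((S : Set ℝ)) = univ :=
    addSubgroup_eq_top_of_irrational_angle S hclosed (θ := θ) hθ h2π hirr
  intro φ
  have : φ ∈ (S : Set ℝ) := hS ▸ mem_univ φ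
  exact this

/-- Registered tools stub `stub_irrationalStabiliserTools` of crux stmt-NavierStokesRegularity-11718 (line
`rdss-screw-split`): the predicate form of the closed-stabiliser lemma, by name. [folklore] -/
theorem stub_irrationalStabiliserTools :
    ∀ (P : ℝ → Prop), P 0 → (∀ φ ψ : ℝ, P φ → P ψ → P (φ + ψ)) → (∀ φ : ℝ, P φ → P (-φ)) → IsClosed {φ : ℝ | P φ} → ∀ θ : ℝ, P θ → P (2 * Real.pi) → Irrational (θ / (2 * Real.pi)) → ∀ φ : ℝ, P φ :=
  fun _ h0 hadd hneg hclosed _ hθ h2π hirr => forall_of_irrational_angle_stabiliser h0 hadd hneg hclosed hθ h2π hirr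

end Summit.NavierStokesRegularity.NavierStokesRegularity.Theorems.SymmetricScarExists.RdssSplit.NearIdentity

end
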